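import Summits.ABC.ABC.Theorems.CongruentialReceptacleTameLocalReceptacleCellLawsDefs

/-!
# Crux `CongruentialReceptacle.TameLocalReceptacle` (stmt-ABC-14354), line `grh-friable-cell-resolution`:
# the engine output with a LOGARITHMIC size interface (`CellLawsPackage₂`)

Lead `prover-line-stmt-ABC-14354-a1-0`, skeleton v6 (2026-08-17).  The engine of the line (the GRH circle method for the five
friable box families) is re-sited in the Lagarias–Soundararajan / Harper polylog regime with a CONSTANT 2-adic depth `N`
(no power imbalance between the special member `2^N m` and its partners).  In that regime the natural precision of a shallow
cell law is `e₁ ≍ 1/log X` while the members have `log c ≍ log X`, so the product `e₁ · log c` — which is what the class /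
valuation discrepancies of `KeyCellStructure` cost — is bounded by an absolute constant `A₀`, and the depth `N ≥ N₁` is free.
`CellLawsPackage` of `…CellLawsDefs.lean` (size clause `c ≤ exp(L·N)`, one precision `e`) encodes instead the abandoned
power-imbalance design; `CellLawsPackage₂` below is the interface the engine actually delivers:

* a shallow-law precision `e₁ ∈ (0, 1/2]` and a logarithmic size bound `Lc` (`log c ≤ Lc` on every family) with `e₁ · Lc ≤ A₀`,
* tails (real and model) bounded by the freely prescribed `e`,
* everything else (shape clauses, friable members, inadmissible vanishing, exponents `α, α' ∈ [3/4, 1]`) as in `CellLawsPackage`.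

The registered stub `stub_keyCells_of_cellLaws₂ : CellLawsPackage₂ (1/4) → TiltBound → KeyCellStructure (1/4)` is the same
bookkeeping as `stub_keyCells_of_cellLaws` (landed file `…StubKeyCellsOfCellLaws.lean`, lemmas `CellLawsBook.*`) with the final
budget `CE, VM ≤ 16·A₀ + C_T + 2e ≤ δ·N` for `N ≥ (16 A₀ + C_T + 3)/δ`.

Deliberately NOT here: the engine, the families, any proof.
-/

-- `Summit.<Summit>.<Problem>` is the mandated summit-side namespace (CONVENTIONS §2); for the
-- single-conjunct summit `ABC` the two coincide, so the duplicate `ABC.ABC` is deliberate.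
set_option linter.dupNamespace false

noncomputable section

namespace Summit.ABC.ABC.Theorems.TameLocalReceptacle

open Finset

/-- LOGARITHMIC SIZE clause: `log c ≤ Lc` for the largest member `c` of every triple of `F` (so the window-weighted key sum of
any member is `≤ 2 log c ≤ 2 Lc`). -/
def LogSizeClause (Lc : ℝ) (F : Finset (ℕ × ℕ × ℕ)) : Prop :=
  ∀ T ∈ F, Real.log (T.2.2 : ℝ) ≤ Lc

/-- **ENGINE OUTPUT, logarithmic interface — the cell-laws package at balance `κ`.**  There are `V₀` and an absolute
constant `A₀` such that for every `e > 0` and every `N₁` there are a depth `N ≥ N₁`, five finite families with the shape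
clauses of `KeyCellStructure κ`, exponents `α, α' ∈ [3/4, 1]`, a friability bound `yb`, a shallowness threshold `Y`, a
shallow-law precision `e₁ ∈ (0, 1/2]` and a size bound `Lc` with `e₁ · Lc ≤ A₀`, such that: `log c ≤ Lc` on all families; all
prime factors are `≤ yb`; inadmissible classes vanish; the SHALLOW LAWS hold with relative error `e₁` against the models with
exponent assignments `FA ↦ (α', α, α)`, `FB ↦ (α, α', α)`, `FC ↦ (α, α, α')`, `G ↦ (α, α, α)`, `G' ↦ (α', α', α')`; and all real
and model tails are `≤ e`. -/
def CellLawsPackage₂ (κ : ℝ) : Prop :=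
  ∃ (V₀ : ℕ) (A₀ : ℝ), ∀ e : ℝ, 0 < e → ∀ N₁ : ℕ, ∃ N : ℕ, N₁ ≤ N ∧
    ∃ FA FB FC G G' : Finset (ℕ × ℕ × ℕ), ∃ (α α' : ℝ) (yb Y : ℕ) (e₁ Lc : ℝ),
      α ∈ Set.Icc (3 / 4 : ℝ) 1 ∧ α' ∈ Set.Icc (3 / 4 : ℝ) 1 ∧
      0 < e₁ ∧ e₁ ≤ 1 / 2 ∧ e₁ * Lc ≤ A₀ ∧
      ShapeClauses κ N V₀ FA FB FC G G' ∧
      (LogSizeClause Lc FA ∧ LogSizeClause Lc FB ∧ LogSizeClause Lc FC ∧ LogSizeClause Lc G ∧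
        LogSizeClause Lc G') ∧
      (FriableMembers yb FA ∧ FriableMembers yb FB ∧ FriableMembers yb FC ∧ FriableMembers yb G ∧
        FriableMembers yb G') ∧
      (InadmissibleVanish FA ∧ InadmissibleVanish FB ∧ InadmissibleVanish FC ∧ InadmissibleVanish G ∧
        InadmissibleVanish G') ∧
      (ShallowLaw e₁ yb Y α' α α FA ∧ ShallowLaw e₁ yb Y α α' α FB ∧ ShallowLaw e₁ yb Y α α α' FC ∧
        ShallowLaw e₁ yb Y α α α G ∧ ShallowLaw e₁ yb Y α' α' α' G') ∧
      (TailSmall e Y FA ∧ TailSmall e Y FB ∧ TailSmall e Y FC ∧ TailSmall e Y G ∧ TailSmall e Y G') ∧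
      (ModelTailSmall e yb Y α' α α ∧ ModelTailSmall e yb Y α α' α ∧ ModelTailSmall e yb Y α α α' ∧
        ModelTailSmall e yb Y α α α ∧ ModelTailSmall e yb Y α' α' α')

/-! ## A registered helper: logarithmic size from a numeric bound -/

/-- **Registered stub `stub_logSizeClause_of_le`** (line `grh-friable-cell-resolution` of crux stmt-ABC-14354): a family whose
largest members are bounded by `B ≥ 1` satisfies the logarithmic size clause with any `Lc ≥ log B` (used by the engine with
`B = 4·2^N·M`). [folklore] -/
theorem stub_logSizeClause_of_le : ∀ (Lc : ℝ) (B : ℕ) (F : Finset (ℕ × ℕ × ℕ)),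
    (∀ T ∈ F, T.2.2 ≤ B) → 1 ≤ B → Real.log B ≤ Lc → LogSizeClause Lc F := by
  intro Lc B F hF hB hlog T hT
  have h1 : (T.2.2 : ℝ) ≤ B := by exact_mod_cast hF T hT
  rcases Nat.eq_zero_or_pos T.2.2 with h0 | hpos
  · have : Real.log ((T.2.2 : ℕ) : ℝ) = 0 := by rw [h0]; simp
    rw [this]
    exact le_trans (Real.log_nonneg (by exact_mod_cast hB)) hlog
  · exact le_trans (Real.log_le_log (by exact_mod_cast hpos) h1) hlog

end Summit.ABC.ABC.Theorems.TameLocalReceptacle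

end
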